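import Literature.RingTheory.KTheory.MilnorKWittRingResidueFieldAscent
import HarnessLib

/-!
# COROLLARY 5.8: affirmative answers to Questions 4.3 (`sₙ : kₙ → Iⁿ/Iⁿ⁺¹` injective) and 4.4 (`⋂ Iⁿ = 0`) for `F` and
# for the residue fields `F[t]/(π)` give affirmative answers for the rational function field `F(t)`
# (Milnor, *Algebraic K-theory and quadratic forms*, Invent. Math. 9 (1970), §5)

Family `hodge`, lane `lit-hodgefound` (foundations library; seat `lit-hodgefound-p27`, generation 42, row g42-#7);
topic `RingTheory/KTheory`.  Sequel of `MilnorKWittRingResidueFieldAscent` (g42-#6: COROLLARY 5.2, `grMk_neg`,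
`gen_sub_one_mul_mem_pow_succ`, `sHom_kmk_cons`), of `MilnorKRatFuncBoundary` (g40-#3, THEOREM 2.3: `MilnorK.psiRat = ψ`,
`MilnorK.boundaryAt = ∂_𝔭`, `MilnorK.constMap`, `forall_boundaryAt_eq_zero_iff`, `exists_forall_boundaryAt_eq`,
`finite_setOf_boundaryAt_ne_zero`, `psiRat_constMap`), of `MilnorKWittRingRatFuncResidues` /
`MilnorKWittRingRatFuncExactSequence` (g41-#7, g42-#2, THEOREM 5.3: `WittRing.retraction = ρ`, `boundaryAtW = ∂_𝔭`,
`retraction_mem_pow`, `boundaryAtW_mem_pow`, `forall_boundaryAtW_eq_zero_iff`), of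
`MilnorKWittRingRatFuncIdealPowersExact` (g42-#3: `sndResidue_gen_pi_sub_one_mul`, `sndResidue_eq_zero_of_mem_closure`,
`rho_gen_mul_prod`), of `MilnorKTameSymbol` (g40-#1: `MilnorK.boundary`, `closure_primeUnitSymbols`,
`boundary_symbol_cons_units`) and of `MilnorKWittRing` (g40: THEOREM 4.1 `WittRing.sHom = sₙ`, `grMk_eq_zero_iff`).
PROVED THEOREMS ONLY; no definition, no named fact, no instance, no notation, 0 `sorry`, net debt 0 (D-0026).

## The source, verbatim

J. Milnor, *Algebraic K-theory and quadratic forms*, Invent. Math. 9 (1970) 318–344 (held `paper:doi-10-1007-bf01425486`;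
bib key `Milnor1970`), §5 (p0022 L11–L14), for `E = F(t)`: «**COROLLARY 5.8.** If the questions 4.3 and 4.4 have
affirmative answers for every finite extension F′ of a field F, then they have affirmative answers for the field
E = F(t) of rational functions. The proof is completely analogous to that of 5.2.»  The proof of 5.2 (p0017 L28–L53):
«Consider the diagram kₙĒ → kₙE → kₙ₋₁Ē over IⁿĒ/Iⁿ⁺¹Ē → IⁿE/Iⁿ⁺¹E → Iⁿ⁻¹Ē/IⁿĒ, where the top sequence comes
from §2.6, the vertical arrows from §4.1, and the bottom sequence is the quotient of (7ₙ) by (7ₙ₊₁). Checking that this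
diagram is commutative, and then applying the Five Lemma, the conclusion follows.»  Here the top sequence is THEOREM 2.3
(p0008 L12–L16) «0 → KₙF → KₙF(t) → ⊕ Kₙ₋₁F[t]/(π) → 0 […] split exact» reduced modulo `2`, and the bottom sequence is
the quotient of LEMMA 5.7 (p0021 L27–L29) «0 → IⁿF → IⁿE → ⊕ Iⁿ⁻¹Ē_π → 0» by its successor.

## What is formalised (`sₙ` is onto `Iⁿ/Iⁿ⁺¹` for every field, so Question 4.3 for `L` reads
`∀ n, Function.Injective (WittRing.sHom L n)`; Question 4.4 reads `(⨅ n, fundIdeal L ^ n) = ⊥`; the residue field of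
the prime `𝔭 = (π)` is `ResidueFieldAt F[X] (RatFunc F) 𝔭`, which `quotientEquivResidueFieldAt` identifies with `F[t]/(π)`)

* §1 «checking that this diagram is commutative», the right square, for ANY discretely valued field `(K, v, π)` and with no
  hypothesis on `K` (sharper than `MilnorKWittRingResidueFieldAscent`, which assumed (H)): for every `x ∈ Kₙ₊₁K` there
  is `Y ∈ Iⁿ⁺¹K` with `sₙ₊₁[x] = grMk Y` and `sₙ^K̄[∂x] = grMk (∂Y)` (`exists_sHom_kmk_eq_and_sHom_kmk_boundary_eq`, by
  the generators `{ϖ, u₂, …}` of Lemma 2.1: `∂{πw, u} = {ū}` against `∂(((πw) − 1)∏((uⱼ) − 1)) = (w̄)∏((ūⱼ) − 1)`),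
  the well-defined form **`grMk_sndResidue_eq_sHom_kmk_boundary`** (`sₙ^K̄[∂x] = grMk(∂y)` whenever `sₙ₊₁[x] = grMk y`),
  and **`kmk_boundary_eq_zero_of_sHom_kmk_eq_zero`** (`sₙ^K̄` injective, `sₙ₊₁[x] = 0 ⇒ [∂x] = 0`).
* §2 the left square for `E = F(t)` with the retractions `ψ : KₙE → KₙF` (Theorem 2.3) and `ρ : W(E) → W(F)` (Lemma
  5.4): `evalZeroHom_symm_eq` / `units_map_evalZeroHom_eq` (the two identifications `κ_(t) ≅ F[t]/(t) ≅ F` and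
  `κ_(t) ≅ F` agree), `retraction_gen` (`ρ((f)) = (f̄)`), `psiRat_symbol`, **`exists_sHom_kmk_eq_and_sHom_kmk_psiRat_eq`**
  (`sₙᴱ[x] = grMk Y` and `sₙ^F[ψx] = grMk (ρY)`), **`kmk_psiRat_eq_zero_of_sHom_kmk_eq_zero`**.
* §3 the top row modulo `2`: **`kmk_eq_zero_of_psiRat_of_boundaryAt`** (`[ψx] = 0` and `[∂_𝔭 x] = 0` for all `𝔭` force
  `[x] = 0` in `kₙ₊₁F(t)` — Theorem 2.3's split exactness, halving the residues).
* §4 **COROLLARY 5.8 for Question 4.3**: **`sHom_ratFunc_succ_injective`** (`sₙ₊₁^F` and all `sₙ^{κ_𝔭}` injective ⇒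
  `sₙ₊₁^{F(t)}` injective), **`sHom_ratFunc_injective`** (all degrees; `s₀` by `sHom_zero_injective`).  No hypothesis on
  the characteristic is needed for this half: the Witt side enters only through `ρ(IᵐE) ⊂ IᵐF` and `∂_𝔭(Iᵐ⁺¹E) ⊂ Iᵐκ_𝔭`.
* §5 **COROLLARY 5.8 for Question 4.4** (`char F ≠ 2`, through Theorem 5.3): **`iInf_pow_fundIdeal_ratFunc_eq_bot`**, and
  the corollary as printed, **`corollary_5_8`** (hypotheses for `F` and for every `κ_𝔭` — these, `κ_𝔭 ≅ F[t]/(π)`, are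
  the finite extensions of `F` the proof uses).
* Not here: the converse transfers; Lemma 4.5 (global fields).

## References

* [Milnor1970] J. Milnor, *Algebraic K-theory and quadratic forms*, Invent. Math. 9 (1970) 318–344 — §5 Corollary 5.8
  (p0022 L11–L14); proof of Corollary 5.2 (p0017 L28–L53); Theorem 2.3 (p0008 L12–L16); Lemma 5.7 (p0021 L27–L30);
  §4 Questions 4.3, 4.4 (p0015 L29–L35).

Provenance: lane `lit-hodgefound`, seat `lit-hodgefound-p27` gen 42 (agent `literature-prover-lit-hodgefound-p27-g42-0`),
row g42-#7.
-/

set_option autoImplicit false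

noncomputable section

namespace Literature.RingTheory.KTheory

open Function Polynomial IsDedekindDomain

namespace WittRing

/-! ### §1 The right square for any discretely valued field: `sₙ[∂x] = grMk(∂Y)` -/

section General

variable {K : Type*} [Field K] (v : Valuation K (WithZero (Multiplicative ℤ))) {π : Kˣ} (hπ : addVal v π = 1)

/-- **The right square, generators and all: every `x ∈ Kₙ₊₁K` has a representative `Y ∈ Iⁿ⁺¹K` of `sₙ₊₁[x]` with
`sₙ^K̄[∂x] = grMk(∂Y)`** (on the generators `{ϖ, u₂, …, uₙ₊₁}`, `ϖ = πw`: `∂{ϖ, u} = {ū}` and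
`∂(((ϖ) − (1))∏((uⱼ) − (1))) = (w̄)∏((ūⱼ) − (1)) ≡ ∏((ūⱼ) − (1))` modulo `Iⁿ⁺¹K̄`). [cite: Milnor1970, §5 proof of Cor. 5.2 «Checking that this diagram is commutative» (p0017 L40–L52); Lemma 2.1 (p0005 L36–L40)] -/
theorem exists_sHom_kmk_eq_and_sHom_kmk_boundary_eq {n : ℕ} (x : MilnorK K (n + 1)) :
    ∃ (Y : WittRing K) (hY : Y ∈ fundIdeal K ^ (n + 1)),
      sHom K (n + 1) (MilnorK.kmk K (n + 1) x) = grMk K (n + 1) Y hY ∧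
        sHom (ValResidueField v) n (MilnorK.kmk (ValResidueField v) n (MilnorK.boundary v hπ n x)) =
          grMk (ValResidueField v) n (sndResidue v hπ Y) (sndResidue_mem_pow v hπ hY) := by
  have hx : x ∈ AddSubgroup.closure (MilnorK.primeUnitSymbols v n) := by
    rw [MilnorK.closure_primeUnitSymbols v hπ]; trivial
  induction hx using AddSubgroup.closure_induction with
  | mem z hz =>
    obtain ⟨ϖ, u, hϖ, hu, rfl⟩ := hz
    refine ⟨(List.ofFn fun j => gen K ((Fin.cons ϖ u : Fin (n + 1) → Kˣ) j) - 1).prod, prod_gen_sub_one_mem K _,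
      ?_, ?_⟩
    · rw [← MilnorK.kSymbol_def, sHom_kSymbol]
    · obtain ⟨w, hw0, hϖw⟩ : ∃ w : Kˣ, addVal v w = 0 ∧ ϖ = π * w :=
        ⟨ϖ * π⁻¹, by rw [addVal_mul, addVal_inv, hϖ, hπ, add_neg_cancel],
          by rw [mul_comm ϖ, ← mul_assoc, mul_inv_cancel, one_mul]⟩
      have hres : (fun j => residueUnitHom v (unitOfEqOne v (u j) (hu j))) = fun j => res v hπ (u j) :=
        funext fun j => (res_of_addVal_eq_zero v hπ (hu j)).symm
      have hY : (List.ofFn fun j => gen K ((Fin.cons ϖ u : Fin (n + 1) → Kˣ) j) - 1).prod =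
          (gen K π - 1) * (gen K w * (List.ofFn fun i => gen K (u i) - 1).prod) +
            (gen K w - 1) * (List.ofFn fun i => gen K (u i) - 1).prod := by
        rw [List.ofFn_succ, List.prod_cons, Fin.cons_zero]
        simp only [Fin.cons_succ]
        rw [hϖw, gen_mul]
        ring
      have hcl₁ := gen_mul_prod_mem_closure v hw0 hu
      have hcl₂ : (gen K w - 1) * (List.ofFn fun i => gen K (u i) - 1).prod ∈
          Subring.closure (gen K '' {u : Kˣ | addVal v u = 0}) := by
        have h1 := gen_mul_prod_mem_closure v (addVal_one v) hu
        rw [gen_one, one_mul] at h1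
        rw [sub_mul, one_mul]
        exact sub_mem hcl₁ h1
      rw [MilnorK.boundary_symbol_cons_units v hπ n hϖ u hu, hres, ← MilnorK.kSymbol_def, sHom_kSymbol,
        grMk_eq_grMk_iff, hY, map_add, sndResidue_gen_pi_sub_one_mul v hπ hcl₁,
        sndResidue_eq_zero_of_mem_closure v hπ hcl₂, add_zero, rho_gen_mul_prod]
      show (List.ofFn fun j => gen (ValResidueField v) (res v hπ (u j)) - 1).prod -
          gen (ValResidueField v) (res v hπ w) *
            (List.ofFn fun i => gen (ValResidueField v) (res v hπ (u i)) - 1).prod ∈ _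
      rw [show ∀ P g : WittRing (ValResidueField v), P - g * P = -((g - 1) * P) from fun P g => by ring]
      exact neg_mem (gen_sub_one_mul_mem_pow_succ _ _ (prod_gen_sub_one_mem _ _))
  | zero =>
    refine ⟨0, zero_mem _, ?_, ?_⟩
    · rw [map_zero (MilnorK.kmk K (n + 1)), map_zero (sHom K (n + 1)), grMk_zero]
    · rw [map_zero (MilnorK.boundary v hπ n), map_zero (MilnorK.kmk (ValResidueField v) n),
        map_zero (sHom (ValResidueField v) n), eq_comm, ← grMk_zero (ValResidueField v) n]
      exact grMk_congr _ (map_zero _) _ _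
  | add x y _ _ hx hy =>
    obtain ⟨A, hA, hA₁, hA₂⟩ := hx
    obtain ⟨B, hB, hB₁, hB₂⟩ := hy
    refine ⟨A + B, add_mem hA hB, ?_, ?_⟩
    · rw [map_add (MilnorK.kmk K (n + 1)), map_add (sHom K (n + 1)), hA₁, hB₁, grMk_add]
    · rw [map_add (MilnorK.boundary v hπ n), map_add (MilnorK.kmk (ValResidueField v) n),
        map_add (sHom (ValResidueField v) n), hA₂, hB₂, grMk_add]
      exact grMk_congr _ (map_add _ _ _).symm _ _
  | neg x _ hx =>
    obtain ⟨A, hA, hA₁, hA₂⟩ := hx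
    refine ⟨-A, neg_mem hA, ?_, ?_⟩
    · rw [map_neg (MilnorK.kmk K (n + 1)), map_neg (sHom K (n + 1)), hA₁, grMk_neg]
    · rw [map_neg (MilnorK.boundary v hπ n), map_neg (MilnorK.kmk (ValResidueField v) n),
        map_neg (sHom (ValResidueField v) n), hA₂, ← grMk_neg]
      exact grMk_congr _ (map_neg _ _).symm _ _

/-- **The right square is commutative, for any discretely valued field: `sₙ^K̄[∂x] = grMk(∂y)` whenever
`sₙ₊₁[x] = grMk y`** (`∂(Iⁿ⁺²K) ⊂ Iⁿ⁺¹K̄` makes the bottom map well defined). [cite: Milnor1970, §5 proof of Cor. 5.2 «the bottom sequence is the quotient of (7ₙ) by (7ₙ₊₁). Checking that this diagram is commutative» (p0017 L40–L52)] -/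
theorem grMk_sndResidue_eq_sHom_kmk_boundary {n : ℕ} (x : MilnorK K (n + 1)) {y : WittRing K}
    {hy : y ∈ fundIdeal K ^ (n + 1)} (h : sHom K (n + 1) (MilnorK.kmk K (n + 1) x) = grMk K (n + 1) y hy) :
    grMk (ValResidueField v) n (sndResidue v hπ y) (sndResidue_mem_pow v hπ hy) =
      sHom (ValResidueField v) n (MilnorK.kmk (ValResidueField v) n (MilnorK.boundary v hπ n x)) := by
  obtain ⟨Y, hY, h₁, h₂⟩ := exists_sHom_kmk_eq_and_sHom_kmk_boundary_eq v hπ x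
  rw [h₂, grMk_eq_grMk_iff, ← map_sub]
  exact sndResidue_mem_pow v hπ ((grMk_eq_grMk_iff _ _ _ _ _).1 (h.symm.trans h₁))

/-- **`sₙ^K̄` injective and `sₙ₊₁[x] = 0` force `[∂x] = 0` in `kₙK̄`.** [cite: Milnor1970, §5 proof of Cor. 5.2, the diagram chase (p0017 L40–L53)] -/
theorem kmk_boundary_eq_zero_of_sHom_kmk_eq_zero {n : ℕ} (hinj : Injective (sHom (ValResidueField v) n))
    {x : MilnorK K (n + 1)} (h : sHom K (n + 1) (MilnorK.kmk K (n + 1) x) = 0) :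
    MilnorK.kmk (ValResidueField v) n (MilnorK.boundary v hπ n x) = 0 := by
  obtain ⟨Y, hY, h₁, h₂⟩ := exists_sHom_kmk_eq_and_sHom_kmk_boundary_eq v hπ x
  have hY' : Y ∈ fundIdeal K ^ (n + 1 + 1) := by rw [← grMk_eq_zero_iff K Y hY, ← h₁]; exact h
  exact hinj (by rw [h₂, map_zero, grMk_eq_zero_iff]; exact sndResidue_mem_pow v hπ hY')

end General

/-! ### §2 The left square for `E = F(t)`: `sₙ^F[ψx] = grMk(ρY)` -/

section RatFunc

variable (F : Type*) [Field F]

/-- The two identifications of the residue field at `(t)` with `F` agree: `κ_(t) ≅ F[t]/(t) →(g ↦ g(0)) F` equals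
`κ_(t) ≅ F`. [cite: Milnor1970, §2 proof of Theorem 2.3 «ψ : K_*F(t) → K_*F» (p0008 L20–L23); §5 proof of Lemma 5.4 «ρ : WE → WF» (p0018 L31–L35)] -/
theorem evalZeroHom_symm_eq (q : ResidueFieldAt F[X] (RatFunc F) (MilnorK.primeT F)) :
    MilnorK.evalZeroHom F ((quotientEquivResidueFieldAt F[X] (RatFunc F) (MilnorK.primeT F)).symm q) =
      (constResidueEquiv F).symm q := by
  obtain ⟨g, rfl⟩ := toResidueFieldAt_surjective F[X] (RatFunc F) (MilnorK.primeT F) q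
  have h1 : (quotientEquivResidueFieldAt F[X] (RatFunc F) (MilnorK.primeT F)).symm
      (toResidueFieldAt F[X] (RatFunc F) (MilnorK.primeT F) g) = Ideal.Quotient.mk (MilnorK.primeT F).asIdeal g := by
    rw [RingEquiv.symm_apply_eq, quotientEquivResidueFieldAt_mk]
  rw [h1, MilnorK.evalZeroHom_mk, toResidueFieldAt_primeT_eq, ← constResidueEquiv_apply, RingEquiv.symm_apply_apply,
    coeff_zero_eq_eval_zero]

/-- The same on units. [cite: Milnor1970, §2 proof of Theorem 2.3 (p0008 L20–L23); §5 proof of Lemma 5.4 (p0018 L31–L35)] -/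
theorem units_map_evalZeroHom_eq (r : (ResidueFieldAt F[X] (RatFunc F) (MilnorK.primeT F))ˣ) :
    Units.map (MilnorK.evalZeroHom F : F[X] ⧸ (MilnorK.primeT F).asIdeal →* F)
        (Units.map ((quotientEquivResidueFieldAt F[X] (RatFunc F) (MilnorK.primeT F)).symm.toRingHom :
            ResidueFieldAt F[X] (RatFunc F) (MilnorK.primeT F) →* F[X] ⧸ (MilnorK.primeT F).asIdeal) r) =
      Units.map ((constResidueEquiv F).symm.toRingHom : ResidueFieldAt F[X] (RatFunc F) (MilnorK.primeT F) →* F) r :=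
  Units.ext (by
    simp only [Units.coe_map, MonoidHom.coe_coe, RingEquiv.toRingHom_eq_coe, RingEquiv.coe_toRingHom]
    exact evalZeroHom_symm_eq F _)

/-- **`ρ((f)) = (f̄)`** for every `f ∈ F(t)•`, `f̄` the residue of the `(t)`-unit part of `f`, read in `F`.
[cite: Milnor1970, §5 Lemma 5.4 «ρ(u) = (ū), ρ(πu) = (ū)» (p0018 L31–L39)] -/
theorem retraction_gen (f : (RatFunc F)ˣ) :
    retraction F (gen (RatFunc F) f) =
      gen F (Units.map ((constResidueEquiv F).symm.toRingHom : ResidueFieldAt F[X] (RatFunc F) (MilnorK.primeT F) →* F)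
        (res ((MilnorK.primeT F).valuation (RatFunc F)) (addVal_monicGen F (MilnorK.primeT F)) f)) := by
  rw [retraction, RingHom.comp_apply, rhoT_def, rho_gen, map_gen]

/-- **`ψ{f₁, …, fₘ} = {f̄₁, …, f̄ₘ}`** read in `F`. [cite: Milnor1970, §2 Lemma 2.2 and proof of Theorem 2.3 «ψ : K_*F(t) → K_*F» (p0007 L46–L49, p0008 L20–L23)] -/
theorem psiRat_symbol {m : ℕ} (f : Fin m → (RatFunc F)ˣ) :
    MilnorK.psiRat F m (MilnorK.symbol f) = MilnorK.symbol fun j =>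
      Units.map (MilnorK.evalZeroHom F : F[X] ⧸ (MilnorK.primeT F).asIdeal →* F)
        (Units.map ((quotientEquivResidueFieldAt F[X] (RatFunc F) (MilnorK.primeT F)).symm.toRingHom :
            ResidueFieldAt F[X] (RatFunc F) (MilnorK.primeT F) →* F[X] ⧸ (MilnorK.primeT F).asIdeal)
          (res ((MilnorK.primeT F).valuation (RatFunc F)) (addVal_monicGen F (MilnorK.primeT F)) (f j))) := by
  rw [MilnorK.psiRat_apply, MilnorK.psi_symbol, MilnorK.map_symbol, MilnorK.map_symbol]

/-- **The left square: every `x ∈ KₘF(t)` has a representative `Y ∈ IᵐF(t)` of `sₘ[x]` with `sₘ^F[ψx] = grMk(ρY)`**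
(on symbols: `sₘ{f} = ∏((fⱼ) − (1))`, `ψ{f} = {f̄}`, `ρ∏((fⱼ) − (1)) = ∏((f̄ⱼ) − (1))`). [cite: Milnor1970, §5 proof of Cor. 5.2 «Checking that this diagram is commutative» (p0017 L40–L52), Lemma 5.4 (p0018 L27–L39), Theorem 2.3 (p0008 L12–L23)] -/
theorem exists_sHom_kmk_eq_and_sHom_kmk_psiRat_eq {m : ℕ} (x : MilnorK (RatFunc F) m) :
    ∃ (Y : WittRing (RatFunc F)) (hY : Y ∈ fundIdeal (RatFunc F) ^ m),
      sHom (RatFunc F) m (MilnorK.kmk (RatFunc F) m x) = grMk (RatFunc F) m Y hY ∧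
        sHom F m (MilnorK.kmk F m (MilnorK.psiRat F m x)) = grMk F m (retraction F Y) (retraction_mem_pow F hY) := by
  induction x using MilnorK.induction_on with
  | hsym k f =>
    refine ⟨(k : WittRing (RatFunc F)) * (List.ofFn fun j => gen (RatFunc F) (f j) - 1).prod,
      Ideal.mul_mem_left _ _ (prod_gen_sub_one_mem _ f), ?_, ?_⟩
    · rw [map_zsmul (MilnorK.kmk (RatFunc F) m), ← MilnorK.kSymbol_def, map_zsmul (sHom (RatFunc F) m), sHom_kSymbol,
        zsmul_grMk]
    · rw [map_zsmul (MilnorK.psiRat F m), psiRat_symbol, map_zsmul (MilnorK.kmk F m), ← MilnorK.kSymbol_def,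
        map_zsmul (sHom F m), sHom_kSymbol, zsmul_grMk]
      refine grMk_congr F (Eq.symm ?_) _ _
      rw [map_mul, map_intCast]
      congr 1
      rw [map_list_prod, List.map_ofFn]
      congr 2
      funext j
      rw [Function.comp_apply, map_sub, map_one, retraction_gen, units_map_evalZeroHom_eq]
  | hadd x y hx hy =>
    obtain ⟨A, hA, hA₁, hA₂⟩ := hx
    obtain ⟨B, hB, hB₁, hB₂⟩ := hy
    refine ⟨A + B, add_mem hA hB, ?_, ?_⟩
    · rw [map_add (MilnorK.kmk (RatFunc F) m), map_add (sHom (RatFunc F) m), hA₁, hB₁, grMk_add]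
    · rw [map_add (MilnorK.psiRat F m), map_add (MilnorK.kmk F m), map_add (sHom F m), hA₂, hB₂, grMk_add]
      exact grMk_congr F (map_add _ _ _).symm _ _

/-- **`sₘ^F` injective and `sₘ^{F(t)}[x] = 0` force `[ψx] = 0` in `kₘF`.** [cite: Milnor1970, §5 proof of Cor. 5.2, the diagram chase (p0017 L40–L53); Cor. 5.8 (p0022 L11–L14)] -/
theorem kmk_psiRat_eq_zero_of_sHom_kmk_eq_zero {m : ℕ} (hinj : Injective (sHom F m)) {x : MilnorK (RatFunc F) m}
    (h : sHom (RatFunc F) m (MilnorK.kmk (RatFunc F) m x) = 0) : MilnorK.kmk F m (MilnorK.psiRat F m x) = 0 := by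
  obtain ⟨Y, hY, h₁, h₂⟩ := exists_sHom_kmk_eq_and_sHom_kmk_psiRat_eq F x
  have hY' : Y ∈ fundIdeal (RatFunc F) ^ (m + 1) := by rw [← grMk_eq_zero_iff _ Y hY, ← h₁]; exact h
  exact hinj (by rw [h₂, map_zero, grMk_eq_zero_iff]; exact retraction_mem_pow F hY')

/-! ### §3 The top row modulo `2` (Theorem 2.3) -/

/-- **Theorem 2.3 modulo `2`: if `[ψx] = 0` in `kₙ₊₁F` and `[∂_𝔭x] = 0` in `kₙ(F[t]/𝔭)` for every `𝔭`, then `[x] = 0` in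
`kₙ₊₁F(t)`** (halve the residues: `∂_𝔭x = 2e_𝔭`, lift `(e_𝔭)` to `u`, then `x − 2u` is a constant `c` with
`c = ψx − 2ψu ∈ 2Kₙ₊₁F`). [cite: Milnor1970, §2 Theorem 2.3 «split exact» (p0008 L12–L16); §5 proof of Cor. 5.2, the top sequence (p0017 L40–L50)] -/
theorem kmk_eq_zero_of_psiRat_of_boundaryAt {n : ℕ} (x : MilnorK (RatFunc F) (n + 1))
    (hψ : MilnorK.kmk F (n + 1) (MilnorK.psiRat F (n + 1) x) = 0)
    (hd : ∀ v : HeightOneSpectrum F[X], MilnorK.kmk (F[X] ⧸ v.asIdeal) n (MilnorK.boundaryAt F n v x) = 0) :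
    MilnorK.kmk (RatFunc F) (n + 1) x = 0 := by
  classical
  have he : ∀ v : HeightOneSpectrum F[X], ∃ e : MilnorK (F[X] ⧸ v.asIdeal) n,
      (2 : ℤ) • e = MilnorK.boundaryAt F n v x ∧ (MilnorK.boundaryAt F n v x = 0 → e = 0) := fun v => by
    by_cases h0 : MilnorK.boundaryAt F n v x = 0
    · exact ⟨0, by rw [h0, zsmul_zero], fun _ => rfl⟩
    · obtain ⟨e, he⟩ := MilnorK.kmk_eq_zero_iff.1 (hd v)
      exact ⟨e, he, fun h => absurd h h0⟩
  choose e he₁ he₂ using he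
  have hfin : {v : HeightOneSpectrum F[X] | e v ≠ 0}.Finite :=
    (MilnorK.finite_setOf_boundaryAt_ne_zero x).subset fun v hv h0 => hv (he₂ v h0)
  obtain ⟨u, hu⟩ := MilnorK.exists_forall_boundaryAt_eq e hfin
  have h0 : ∀ v : HeightOneSpectrum F[X], MilnorK.boundaryAt F n v (x - (2 : ℤ) • u) = 0 := fun v => by
    rw [map_sub, map_zsmul, hu, he₁, sub_self]
  obtain ⟨c, hc⟩ := AddMonoidHom.mem_range.1 ((MilnorK.forall_boundaryAt_eq_zero_iff _).1 h0)
  obtain ⟨d, hd'⟩ := MilnorK.kmk_eq_zero_iff.1 hψ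
  have hcd : c = (2 : ℤ) • (d - MilnorK.psiRat F (n + 1) u) := by
    have h := congrArg (MilnorK.psiRat F (n + 1)) hc
    rw [MilnorK.psiRat_constMap, map_sub, map_zsmul, ← hd'] at h
    rw [h, zsmul_sub]
  refine MilnorK.kmk_eq_zero_iff.2 ⟨u + MilnorK.constMap F (n + 1) (d - MilnorK.psiRat F (n + 1) u), ?_⟩
  rw [zsmul_add, ← map_zsmul, ← hcd, hc, add_sub_cancel]

/-! ### §4 COROLLARY 5.8 for Question 4.3 -/

/-- **COROLLARY 5.8 (Question 4.3), one degree: if `sₙ₊₁^F` and every `sₙ^{κ_𝔭}` (`κ_𝔭 = F[t]/𝔭`) are injective then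
`sₙ₊₁^{F(t)}` is injective** — no hypothesis on the characteristic. [cite: Milnor1970, §5 Corollary 5.8 «The proof is completely analogous to that of 5.2» (p0022 L11–L14); proof of Cor. 5.2 (p0017 L40–L53)] -/
theorem sHom_ratFunc_succ_injective {n : ℕ} (hF : Injective (sHom F (n + 1)))
    (hres : ∀ v : HeightOneSpectrum F[X], Injective (sHom (ResidueFieldAt F[X] (RatFunc F) v) n)) :
    Injective (sHom (RatFunc F) (n + 1)) := by
  refine (injective_iff_map_eq_zero _).2 fun ξ hξ => ?_
  obtain ⟨x, rfl⟩ := MilnorK.kmk_surjective ξ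
  refine kmk_eq_zero_of_psiRat_of_boundaryAt F x (kmk_psiRat_eq_zero_of_sHom_kmk_eq_zero F hF hξ) fun v => ?_
  have h := kmk_boundary_eq_zero_of_sHom_kmk_eq_zero (v.valuation (RatFunc F)) (addVal_monicGen F v) (hres v) hξ
  obtain ⟨z, hz⟩ := MilnorK.kmk_eq_zero_iff.1 h
  rw [MilnorK.boundaryAt_apply, ← hz, map_zsmul]
  exact MilnorK.kmk_two_zsmul _

/-- **COROLLARY 5.8 (Question 4.3): if every `sₙ^F` and every `sₙ^{κ_𝔭}` is injective (hence bijective), then so is every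
`sₙ^{F(t)}`.** [cite: Milnor1970, §5 Corollary 5.8 (p0022 L11–L14); §4 Question 4.3 (p0015 L31–L32)] -/
theorem sHom_ratFunc_injective (hF : ∀ n, Injective (sHom F n))
    (hres : ∀ (v : HeightOneSpectrum F[X]) (n : ℕ), Injective (sHom (ResidueFieldAt F[X] (RatFunc F) v) n)) (n : ℕ) :
    Injective (sHom (RatFunc F) n) := by
  cases n with
  | zero => exact sHom_zero_injective (RatFunc F)
  | succ n => exact sHom_ratFunc_succ_injective F (hF (n + 1)) fun v => hres v n

/-! ### §5 COROLLARY 5.8 for Question 4.4, and the corollary as printed -/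

/-- **COROLLARY 5.8 (Question 4.4): for `char F ≠ 2`, if `⋂ IⁿF = 0` and `⋂ Iⁿκ_𝔭 = 0` for every `𝔭`, then
`⋂ IⁿF(t) = 0`** (`w` with all `∂_𝔭w = 0` is a constant `ι(b)` by Theorem 5.3, and `b = ρ(w) ∈ ⋂ IⁿF = 0`).
[cite: Milnor1970, §5 Corollary 5.8 (p0022 L11–L14); Theorem 5.3 (p0018 L12–L15); Lemma 5.7 (p0021 L27–L30)] -/
theorem iInf_pow_fundIdeal_ratFunc_eq_bot (h2 : (2 : F) ≠ 0) (hF : (⨅ n : ℕ, fundIdeal F ^ n) = ⊥)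
    (hres : ∀ v : HeightOneSpectrum F[X], (⨅ n : ℕ, fundIdeal (ResidueFieldAt F[X] (RatFunc F) v) ^ n) = ⊥) :
    (⨅ n : ℕ, fundIdeal (RatFunc F) ^ n) = ⊥ := by
  refine eq_bot_iff.2 fun w hw => ?_
  have hw' : ∀ n : ℕ, w ∈ fundIdeal (RatFunc F) ^ n := fun n => (Ideal.mem_iInf.1 hw) n
  have h0 : ∀ v : HeightOneSpectrum F[X], boundaryAtW F v w = 0 := fun v => by
    have h' : boundaryAtW F v w ∈ ⨅ n : ℕ, fundIdeal (ResidueFieldAt F[X] (RatFunc F) v) ^ n :=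
      Ideal.mem_iInf.2 fun n => boundaryAtW_mem_pow F v (hw' (n + 1))
    rwa [hres v, Ideal.mem_bot] at h'
  obtain ⟨b, rfl⟩ := (forall_boundaryAtW_eq_zero_iff h2 w).1 h0
  have hb : b = 0 := by
    have h' : retraction F (constMapW F b) ∈ ⨅ n : ℕ, fundIdeal F ^ n :=
      Ideal.mem_iInf.2 fun n => retraction_mem_pow F (hw' n)
    rwa [hF, Ideal.mem_bot, retraction_constMapW] at h'
  rw [hb, map_zero]
  exact Ideal.zero_mem _

/-- **COROLLARY 5.8, as printed: «If the questions 4.3 and 4.4 have affirmative answers for every finite extension F′ of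
a field F, then they have affirmative answers for the field E = F(t) of rational functions»** — with the hypotheses
placed on the finite extensions the proof uses: `F` itself and the residue fields `κ_𝔭 ≅ F[t]/𝔭`; `char F ≠ 2`.
[cite: Milnor1970, §5 Corollary 5.8 (p0022 L11–L14)] -/
theorem corollary_5_8 (h2 : (2 : F) ≠ 0) (h43F : ∀ n, Injective (sHom F n))
    (h44F : (⨅ n : ℕ, fundIdeal F ^ n) = ⊥)
    (h43 : ∀ (v : HeightOneSpectrum F[X]) (n : ℕ), Injective (sHom (ResidueFieldAt F[X] (RatFunc F) v) n))
    (h44 : ∀ v : HeightOneSpectrum F[X], (⨅ n : ℕ, fundIdeal (ResidueFieldAt F[X] (RatFunc F) v) ^ n) = ⊥) :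
    (∀ n, Injective (sHom (RatFunc F) n)) ∧ (⨅ n : ℕ, fundIdeal (RatFunc F) ^ n) = ⊥ :=
  ⟨sHom_ratFunc_injective F h43F h43, iInf_pow_fundIdeal_ratFunc_eq_bot F h2 h44F h44⟩

end RatFunc

end WittRing

end Literature.RingTheory.KTheory
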